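import Summits.ABC.IUTFork.DAGC312q
import Summits.ABC.IUTFork.DAGC312s
import Summits.ABC.IUTFork.DAGC312t
import Summits.ABC.IUTFork.DAGC312u

/-!
# Kernel DAG index — layer C312, part v: THE COR. 3.12 KERNEL CENSUS IN ONE THEOREM (for the 11:30Z team lines / 13:00Z block to cite by ONE name)

index v1 · abc-iut-c312-2 (filer, gen 3). PROOF-ONLY; a conjunction of ALREADY-LANDED index theorems (parts n–u), nothing new. For a full
situation `S` (Theorem 3.11's typed situation, abc-iut-c312-1), a verbatim setting `P` over it (abc-iut-c312-7) with strips datum `D`, and any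
`pending : Locus → Prop`, `cor312_kernel_census` records, BY NAME:

1. LOCI — given Theorem 3.11 as typed and (IPL): the reading of record holds at all 85 cited loci iff… it needs only `pending .SHE`
   (`lociReadingI_of_SHE'`), and in the least reading the disputed (xi-f) observation is derivable ↔ (SHE) is granted (`derivable_xi_f_iff_SHE'`);
2. STEPS — given the named side data (three coarse-volume properties of `S.D P.n`, strip-iso nonemptiness, `ThetaFinite`, `AbsLogQPos`): the
   twenty-node chain under the readings of record ↔ the typed Statement (`chain_of_record_iff_statement`);
3. THE ONE NODE — given `ThetaFinite`, `AbsLogQPos`: the (xi-f) node ↔ Statement ↔ `GapGlobal` (any strip algorithm) ↔ `SoundAtPilot` (any gluing)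
   (`xi_f_levels`), and its value is independent of `pending` (`xi_f_node_indep_pending`);
4. READINGS — the node is granted by the identified-copies reading trivially (with `not_encodes`) and by R4 `IsoContainment` (and R1–R3, (9-1),
   Team B's routes: part r) (`xi_f_fork`);
5. NON-VACUITY — over full situations where Theorem 3.11 as typed holds, the node is TRUE somewhere and FALSE somewhere
   (`xi_f_node_undecided_by_typed_thm311`).
No side taken on [IUTchIII] Cor. 3.12; typed ≠ discharged; indexed ≠ endorsed. [claim: Mochizuki2012, status: disputed]
-/

noncomputable section

namespace Summit.ABC.IUTFork.DAG

open Cor312Proof Thm311 Cor312Vol InputStrip Literature.IUT.LogThetaLattice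

/-- **THE COR. 3.12 KERNEL CENSUS** (conjuncts 1–5 of the module docstring, in that order; every conjunct an already-landed theorem BY NAME).
[claim: Mochizuki2012, status: disputed] -/
theorem cor312_kernel_census {T : ThetaIndex} (S : FullSituation T) (pending : Locus → Prop) (P : Cor312.Setting S.toSituation)
    (D : ThetaLinkStrips P.LogLink P.Strip) :
    -- 1. loci
    ((S.Statement → S.link.IPL → pending .SHE → ∀ c, lociReadingI S pending c) ∧
      (S.Statement → S.link.IPL → (Derivable (lociReadingI S pending) .constitutesConstruction ↔ pending .SHE))) ∧
    -- 2. steps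
    ((∀ Φ ∈ S.L.Ind1Family ∪ S.L.Ind2Family, ∀ (j : T.Label) (vQ : T.VQ) (A : Set (S.L.Packet j vQ)),
        (S.D P.n).Adm j vQ A ↔ (S.D P.n).Adm j vQ (Φ j vQ '' A)) →
      (S.D P.n).LogvolInvariant →
      (∀ (j : T.Label) (vQ : T.VQ) (A B : Set (S.L.Packet j vQ)),
        (S.D P.n).Adm j vQ A → (S.D P.n).Adm j vQ B → A ⊆ B → (S.D P.n).logvol j vQ A ≤ (S.D P.n).logvol j vQ B) →
      (∀ n m : ℤ, Nonempty (P.IsoS (D.stripLGP (P.lattice.logLink n (m - 1))) (D.stripDelta (P.lattice.theater (n + 1) m)))) →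
      P.ThetaFinite → P.AbsLogQPos →
        (N_IUTchIII_Cor3_12_pf (lociReadingI S pending) (obsReadingA S pending P D) ↔ P.Statement)) ∧
    -- 3. the one node
    (P.ThetaFinite → P.AbsLogQPos → ∀ (A : StripAlgorithm P) (G : LinkGluing P),
      (N_IUTchIII_Cor3_12_pf_xi_f (lociReadingI S pending) (obsReadingA S pending P D) ↔ P.Statement) ∧
      (N_IUTchIII_Cor3_12_pf_xi_f (lociReadingI S pending) (obsReadingA S pending P D) ↔ A.GapGlobal) ∧
      (N_IUTchIII_Cor3_12_pf_xi_f (lociReadingI S pending) (obsReadingA S pending P D) ↔ SoundAtPilot P G)) ∧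
    (∀ pending' : Locus → Prop, N_IUTchIII_Cor3_12_pf_xi_f (lociReadingI S pending) (obsReadingA S pending P D) ↔
      N_IUTchIII_Cor3_12_pf_xi_f (lociReadingI S pending') (obsReadingA S pending' P D)) ∧
    -- 4. readings
    (P.ThetaFinite → P.AbsLogQPos →
      (∀ H : BridgeHyps P, IsoContainment P → N_IUTchIII_Cor3_12_pf_xi_f (lociReadingI S pending) (obsReadingA S pending P D)) ∧
      (P.IdentifiedReading → N_IUTchIII_Cor3_12_pf_xi_f (lociReadingI S pending) (obsReadingA S pending P D) ∧
        ¬ ∃ w : ℝ, 1 < w ∧ P.negLogTheta = ((w * P.negLogQ : ℝ) : WithTop ℝ))) ∧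
    -- 5. non-vacuity (situation-independent)
    ((∃ (T' : ThetaIndex) (S' : FullSituation T') (P' : Cor312.Setting S'.toSituation) (D' : ThetaLinkStrips P'.LogLink P'.Strip),
        S'.Statement ∧ P'.ThetaFinite ∧ P'.AbsLogQPos ∧
          ∀ pe : Locus → Prop, N_IUTchIII_Cor3_12_pf_xi_f (lociReadingI S' pe) (obsReadingA S' pe P' D')) ∧
      (∃ (T' : ThetaIndex) (S' : FullSituation T') (P' : Cor312.Setting S'.toSituation) (D' : ThetaLinkStrips P'.LogLink P'.Strip),
        S'.Statement ∧ P'.ThetaFinite ∧ P'.AbsLogQPos ∧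
          ∀ pe : Locus → Prop, ¬ N_IUTchIII_Cor3_12_pf_xi_f (lociReadingI S' pe) (obsReadingA S' pe P' D'))) :=
  ⟨⟨fun hS hI hSHE => lociReadingI_of_SHE' S pending hS hI hSHE, fun hS hI => derivable_xi_f_iff_SHE' S pending hS hI⟩,
    fun h1 h2 h3 h4 hfin hq => chain_of_record_iff_statement S pending P D h1 h2 h3 h4 hfin hq,
    fun hfin hq A G => xi_f_levels S pending P D A G hfin hq,
    fun pending' => xi_f_node_indep_pending S pending pending' P D,
    fun hfin hq => (xi_f_fork S pending P D hfin hq).2,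
    xi_f_node_undecided_by_typed_thm311⟩

end Summit.ABC.IUTFork.DAG

end
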